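import Summits.HodgeConjecture.HodgeConjecture.Theorems.MarkmanPartnerTransportPicardThreeK3SquaresRMTypeOpenDescent
import HarnessLib

/-!
# Route MarkmanPartnerTransport · crux `PicardThreeK3Squares` (stmt-HodgeConjecture-19652) —
# the isogeny class of a real-multiplication K3 surface is DENSE in its Hodge locus

Cell hodge-nonav, crux #4 (HC⁴(S ⊗ S), ρ(S) ≥ 3; open core: real multiplication), programme «RATIONAL ORBIT
DENSITY» (prover seat hodge-nonav-19652-p1 gen 10; `--supports stmt-HodgeConjecture-19652`, helper).
CONDITIONAL on the named fact `Huybrechts_K3_periodSurjective_projective` only; credits nothing; nothing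
here says HC is proved.

`exists_isogenous_markedK3_mem_of_isOpen`: for a `k3Form`-self-adjoint `θ ∈ M₂₂(ℚ)` with an eigenprojector
certificate at the real eigenvalue `e ≠ 0`, a marked projective K3 surface `(S, η, p, x)` whose period is
carried by a rational isometry `σ ∈ O(Λ_ℚ)` to a `θ`-generic point of the Hodge locus `D_{θ,e}`, and ANY open
`U ⊂ Λ_ℂ` meeting `D_{θ,e}`: there is a marked projective K3 surface `(S', η', p', y')` with `y' ∈ U` a
`θ`-generic point of `D_{θ,e}` together with a rational isometry `τ` of `(Λ_ℂ, k3Form)` with `τ y' = c·x` —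
so `η⁻¹ τ η'` is a rational Hodge isometry `H²(S', ℚ) ⥲ H²(S, ℚ)`: **`S` is isogenous to a K3 surface with
period in `U`**. In words: up to isogeny, the real-multiplication Noether–Lefschetz locus of type `θ` is a
single `G_θ(ℚ)`-orbit closure; in particular (once a maximal van Geemen–Schütt family is typed) every K3
surface of that rational RM type is isogenous to a member of the family. Proof: RATIONAL ORBIT DENSITY
(`exists_ratIsometry_commute_smul_mem_of_isOpen`; `θ` kills the positive rational vector `σu`) + the
surjectivity of the period map (`exists_markedK3_ratIsometry`, `markedK3_smul`); `θ`-genericity is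
transported along the centraliser element. No definition, no sorry.

References: Huybrechts, *Lectures on K3 Surfaces*, Ch. 6 Prop. 1.5, Rem. 3.3, Ch. 7 Thm. 4.1; Buskin,
J. reine angew. Math. 755 (2019), §6.2; O'Meara, *Introduction to Quadratic Forms*, §42–§43B; van
Geemen–Schütt, Forum Math. Sigma 13 (2025) e2, §3.4.
-/

set_option linter.dupNamespace false

noncomputable section

namespace Summit.HodgeConjecture.HodgeConjecture.Theorems.MarkmanPartnerTransport.RMTypeOrbit

open CategoryTheory MonoidalCategory Polynomial
open Literature.AlgebraicGeometry Literature.AlgebraicGeometry.Motives Literature.AlgebraicGeometry.HodgeTheory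
open Literature.AlgebraicGeometry.Surfaces Literature.LinearAlgebra.QuadraticForm
open Literature.AlgebraicTopology.SingularHomology
open Summit.HodgeConjecture.HodgeConjecture.Theorems.NikulinTwinTransport
open Summit.HodgeConjecture.HodgeConjecture.Theorems.MarkmanPartnerTransport.IsogenyInvariance
open Summit.HodgeConjecture.HodgeConjecture.Theorems.MarkmanPartnerTransport.RMTypeDescent

/-- `MarkedK3[S, η, p, x]`: VERBATIM the `let MarkedK3 := …` binder of the route declaration
`PicardThreeK3Squares` (as in `…RMTypeDescent`). Local notation only. -/
local notation3 (prettyPrint := false) "MarkedK3[" S ", " η ", " p ", " x "]" =>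
  (p ≠ 0 ∧ (IsIntegralClass p ∧
    (∀ q : complexBetti S (2 * 2), IsIntegralClass q → ∃ n : ℤ, q = n • p) ∧
    (∀ c : complexBetti S (2 * 1), IsIntegralClass c ↔ ∃ v : K3Index → ℤ, η c = fun i => (v i : ℂ)) ∧
    (∀ a b : complexBetti S (2 * 1),
      cupProduct (rfl : 2 * 1 + 2 * 1 = 2 * 2) a b = k3Form (η a) (η b) • p) ∧
    IsOfHodgeType 2 S (2 * 1) 2 0 (LinearEquiv.symm η x) ∧
    (∀ τ : complexBetti S (2 * 1), IsOfHodgeType 2 S (2 * 1) 2 0 τ →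
      ∃ t : ℂ, τ = t • LinearEquiv.symm η x)) ∧
    (k3Form x x = 0 ∧ 0 < (k3Form (star x) x).re ∧
      ∃ u : K3Index → ℤ, k3Form (fun i => (u i : ℂ)) x = 0 ∧ 0 < ∑ i, ∑ j, u i * k3Gram i j * u j))

variable {S : SchemeOver ℂ} {θ : Matrix K3Index K3Index ℚ}

/-- **Every marked projective K3 surface of rational RM type `θ` is ISOGENOUS to one whose period lies in any
prescribed open subset of the Hodge locus.** Let `θ ∈ M₂₂(ℚ)` be `k3Form`-self-adjoint with an
eigenprojector certificate `π` at the real eigenvalue `e ≠ 0`, `(S, η, p, x)` a marked projective K3 surface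
and `σ ∈ O(Λ_ℚ)` a rational isometry carrying its period to a `θ`-GENERIC point `σx ∈ D_{θ,e}`. Then for
every open `U ⊂ Λ_ℂ` meeting `D_{θ,e}` there are a marked projective K3 surface `(S', η', p', y')` with
`y' ∈ U` a `θ`-generic point of `D_{θ,e}` and a rational isometry `τ` of `(Λ_ℂ, k3Form)` carrying `y'` into
the period line of `S` (`τ y' = c·x`) — i.e. `η⁻¹ ∘ τ ∘ η'` is a rational Hodge isometry `H²(S',ℚ) ⥲ H²(S,ℚ)`:
«up to isogeny the RM Hodge locus is a single `G_θ(ℚ)`-orbit closure». Mod the surjectivity of the period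
map; fact-free otherwise. [cite: Huybrechts2016K3, Ch. 6 Prop. 1.5, Rem. 3.3 and Ch. 7 Thm. 4.1]
[cite: Buskin2019, §6.2] [cite: Omeara1963, §42–§43B] -/
theorem exists_isogenous_markedK3_mem_of_isOpen
    (hPS : Huybrechts_K3_periodSurjective_projective)
    (hθsa : ∀ a b : K3Index → ℂ, k3Form (thetaC θ a) b = k3Form a (thetaC θ b))
    {e : ℝ} (he : e ≠ 0) {π : ℂ[X]} (hπe : π.eval (e : ℂ) = 1)
    (hπW : ∀ y : K3Index → ℂ,
      thetaC θ (aeval (thetaC θ) π (thetaC θ y)) = (e : ℂ) • aeval (thetaC θ) π (thetaC θ y))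
    (η : complexBetti S (2 * 1) ≃ₗ[ℂ] (K3Index → ℂ)) (p : complexBetti S (2 * 2)) (x : K3Index → ℂ)
    (hM : MarkedK3[S, η, p, x])
    (σ : Module.End ℂ (K3Index → ℂ)) (hσ : ∀ a b, k3Form (σ a) (σ b) = k3Form a b)
    (hσrat : ∀ v : K3Index → ℤ, ∃ w : K3Index → ℚ, σ (fun i => (v i : ℂ)) = fun i => (w i : ℂ))
    (heig : thetaC θ (σ x) = (e : ℂ) • σ x)
    (hgenσ : ∀ v : K3Index → ℚ, k3Form (fun i => (v i : ℂ)) (σ x) = 0 → θ.mulVec v = 0)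
    {U : Set (K3Index → ℂ)} (hU : IsOpen U) {y₁ : K3Index → ℂ} (hy₁U : y₁ ∈ U)
    (hy₁ : thetaC θ y₁ = (e : ℂ) • y₁) (h₁₁ : k3Form y₁ y₁ = 0) (h₁p : 0 < (k3Form (star y₁) y₁).re) :
    ∃ (S' : SchemeOver ℂ) (_ : IsK3Surface S') (η' : complexBetti S' (2 * 1) ≃ₗ[ℂ] (K3Index → ℂ))
      (p' : complexBetti S' (2 * 2)) (y' : K3Index → ℂ), y' ∈ U ∧ MarkedK3[S', η', p', y'] ∧
      thetaC θ y' = (e : ℂ) • y' ∧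
      (∀ v : K3Index → ℚ, k3Form (fun i => (v i : ℂ)) y' = 0 → θ.mulVec v = 0) ∧
      ∃ (τ : Module.End ℂ (K3Index → ℂ)) (c : ℂ), (∀ a b, k3Form (τ a) (τ b) = k3Form a b) ∧
        (∀ v : K3Index → ℤ, ∃ w : K3Index → ℚ, τ (fun i => (v i : ℂ)) = fun i => (w i : ℂ)) ∧
        τ y' = c • x := by
  classical
  obtain ⟨hp0, ⟨hpint, hpgen, hηint, hηcup, h20, hline⟩, hPer⟩ := hM
  -- a positive rational vector killed by `θ`
  obtain ⟨u, hux, hupos⟩ := hPer.2.2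
  obtain ⟨w, hw⟩ := hσrat u
  have hθw : θ.mulVec w = 0 := hgenσ w (by rw [← hw, hσ, hux])
  have hwpos : 0 < k3FormRat w w := by
    have h1 : (k3FormRat w w : ℚ) = ((∑ i, ∑ j, u i * k3Gram i j * u j : ℤ) : ℚ) := by
      apply Rat.cast_injective (α := ℂ)
      rw [← k3Form_ratCast, ← hw, hσ, intCast_eq_ratCast_intCast, k3Form_ratCast, k3FormRat_intCast]
    rw [h1]
    exact_mod_cast hupos
  have hPσ := periodPt_ratIsometry σ hσ hσrat hPer
  obtain ⟨g, c, hc0, hgiso, hgrat, hgcomm, hgU⟩ := exists_ratIsometry_commute_smul_mem_of_isOpen hθsa he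
    hπe hπW ⟨w, hθw, hwpos⟩ heig hPσ.1 hPσ.2.1 hU hy₁U hy₁ h₁₁ h₁p
  set σ₁ : Module.End ℂ (K3Index → ℂ) := g ∘ₗ σ with hσ₁def
  have hσ₁ : ∀ a b, k3Form (σ₁ a) (σ₁ b) = k3Form a b := fun a b => by
    rw [hσ₁def, LinearMap.comp_apply, LinearMap.comp_apply, hgiso, hσ]
  have hσ₁rat : ∀ v : K3Index → ℤ, ∃ w : K3Index → ℚ, σ₁ (fun i => (v i : ℂ)) = fun i => (w i : ℂ) := by
    intro v
    obtain ⟨w₁, hw₁⟩ := hσrat v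
    obtain ⟨w₂, hw₂⟩ := ratEnd_ratCast g hgrat w₁
    exact ⟨w₂, by rw [hσ₁def, LinearMap.comp_apply, hw₁, hw₂]⟩
  have heig₁ : thetaC θ (c • σ₁ x) = (e : ℂ) • (c • σ₁ x) := by
    have hgx := LinearMap.congr_fun hgcomm (σ x)
    simp only [LinearMap.comp_apply] at hgx
    rw [hσ₁def, LinearMap.comp_apply, map_smul, ← hgx, heig, map_smul, smul_comm]
  have hgen₁ : ∀ v : K3Index → ℚ, k3Form (fun i => (v i : ℂ)) (c • σ₁ x) = 0 → θ.mulVec v = 0 := by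
    intro v hv
    obtain ⟨g', hgg', -, -, hg'rat⟩ := exists_inverse_ratIsometry g hgiso hgrat
    obtain ⟨v', hv'⟩ := ratEnd_ratCast g' hg'rat v
    have hv'x : k3Form (fun i => (v' i : ℂ)) (σ x) = 0 := by
      rw [← hv', ← hgiso (g' _) (σ x), hgg']
      rw [k3Form_smul_right, hσ₁def, LinearMap.comp_apply] at hv
      rcases mul_eq_zero.1 hv with h | h
      · exact absurd h hc0
      · exact h
    have h1 := hgenσ v' hv'x
    have h2 : thetaC θ (fun i => (v i : ℂ)) = 0 := by
      have hgv := LinearMap.congr_fun hgcomm (fun i => (v' i : ℂ))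
      simp only [LinearMap.comp_apply] at hgv
      rw [← hgg' (fun i => (v i : ℂ)), hv', ← hgv, thetaC_ratCast, h1]
      have h0 : (fun i => ((0 : K3Index → ℚ) i : ℂ)) = 0 := by funext i; simp
      rw [h0, map_zero]
    rw [thetaC_ratCast] at h2
    funext i
    have h3 := congrFun h2 i
    simp only [Pi.zero_apply] at h3
    exact_mod_cast h3
  obtain ⟨S', hS', η', p', hM'⟩ := exists_markedK3_ratIsometry hPS σ₁ hσ₁ hσ₁rat hPer
  have hM'' := markedK3_smul hM' hc0
  have hcσ₁U : c • σ₁ x ∈ U := by rw [hσ₁def, LinearMap.comp_apply]; exact hgU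
  obtain ⟨σ₁', -, hσ₁'σ, hσ₁', hσ₁'rat⟩ := exists_inverse_ratIsometry σ₁ hσ₁ hσ₁rat
  exact ⟨S', hS', η', p', c • σ₁ x, hcσ₁U, hM'', heig₁, hgen₁, σ₁', c, hσ₁', hσ₁'rat,
    by rw [map_smul, hσ₁'σ]⟩

end Summit.HodgeConjecture.HodgeConjecture.Theorems.MarkmanPartnerTransport.RMTypeOrbit

end
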